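import Summits.FinalStateConjecture.FinalStateConjecture.Theorems.EIHFluxBalanceInertialRecessionStubRechart3ClockMap
import Summits.FinalStateConjecture.FinalStateConjecture.Theorems.EIHFluxBalanceInertialRecessionStubRechart3Carter
import Summits.FinalStateConjecture.FinalStateConjecture.Theorems.EIHFluxBalanceInertialRecessionLorentz

/-!
# Route EIHFluxBalance — `InertialRecession`, re-charting: the clock chart RAISES LAB TIME along
# the Carter field (certification input for the transfer of rotating holes)

Helper file for the crux `stmt-FinalStateConjecture-10166`
(`Summit.FinalStateConjecture.FinalStateConjecture.Theses.EIHFluxBalance.InertialRecession`),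
stub `stub_rechart` (the transfer P2 of line `sublinear-is-free-clean-window-charges`).

The certification `isFutureDirected_mfderiv_flow_of_deviation` (…RechartFlowOrbit) of the Carter
direction `χ` for a re-charted clock chart `Φ ∘ A`, `A = honestChart Λ̃ ξ T₀` near late points of
bounded rest offset (…StubRechart3Package), needs `0 < (DA(y)χ(y))⁰ = DT(y)χ(y)` for the clock map
`T = clockMap Λ̃ T₀`. By `hasFDerivAt_clockMap`,
`DT(y)χ = T₀'(y⁰)(1 + (frameTilt ∘ Λ̃)'(T₀ y⁰) ỹ) χ⁰ + frameTilt(Λ̃(T₀ y⁰)) χ̃` with `χ⁰ = 1`,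
`‖χ̃‖² ≤ a²/(r² + a²) ≤ 1/2` for `r ≥ |a|` (`norm_spatial_carterField_le`), the tilt bound
`|frameTilt Λ z| ≤ √((u⁰)² − 1) ‖z‖ ≤ u⁰‖z‖`, `u = Λe₀` (`abs_frameTilt_le`), the proper-time clock
`T₀' = ũ⁰ ≥ 1` (orthochronous normalised frame) and the slaved tilt rate `(frameTilt ∘ Λ̃)' → 0`:
eventually in the chart time, on `{‖ỹ‖ ≤ K, r ≥ |a|}`, `DT(y)χ(y) ≥ ũ⁰/8 ≥ 1/8`
(`clockMap_carter_timeRaising`), and the same for `(D(honestChart) χ)⁰`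
(`honestChart_carter_timeRaising`).
[Carter 1968; O'Neill 1983, Ch. 9; folklore]
-/

noncomputable section

set_option linter.dupNamespace false

open Set Filter Topology Function TopologicalSpace Literature.Geometry.Lorentzian
open Summit.FinalStateConjecture.FinalStateConjecture.Theorems.SublinearIsFree.Rechart
open scoped Manifold ContDiff InnerProductSpace

namespace Summit.FinalStateConjecture.FinalStateConjecture.Theorems

/-! ### The tilt covector is bounded by the boost part of the frame -/

/-- **Tilt bound**: `|frameTilt Λ z| ≤ √(((Λe₀)⁰)² − 1) ‖z‖` — the tilt is the inner product with
the spatial part of `Λ⁻¹e₀`, whose length is `√((u⁰)² − 1)`. O'Neill 1983, Ch. 9, p. 233.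
[folklore] -/
theorem abs_frameTilt_le (Λ : lorentzGroup) (z : E3) :
    |frameTilt Λ z| ≤ Real.sqrt ((((Λ : E4 ≃L[ℝ] E4) (E4.basisVector 0)) 0) ^ 2 - 1) * ‖z‖ := by
  -- `(Λ(0,z))⁰ = −⟪(Λ⁻¹e₀)~, z⟫`
  have h1 : frameTilt Λ z = -inner ℝ (E4.spatial ((Λ : E4 ≃L[ℝ] E4).symm (E4.basisVector 0))) z := by
    rw [frameTilt_apply]
    have h := minkowski_bilin_basisVector_zero_left ((Λ : E4 ≃L[ℝ] E4) (E4.ofTimeSpace 0 z))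
    have hinv := Λ.2 (E4.ofTimeSpace 0 z) ((Λ : E4 ≃L[ℝ] E4).symm (E4.basisVector 0))
    rw [ContinuousLinearEquiv.apply_symm_apply,
      Minkowski.bilin_symm ((Λ : E4 ≃L[ℝ] E4) (E4.ofTimeSpace 0 z)) (E4.basisVector 0),
      Minkowski.bilin_symm (E4.ofTimeSpace 0 z),
      minkowski_bilin_of_apply_zero_eq_zero _ (E4.ofTimeSpace_apply_zero 0 z),
      E4.spatial_ofTimeSpace] at hinv
    linarith
  -- `‖(Λ⁻¹e₀)~‖² = (u⁰)² − 1`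
  have h4 : ‖E4.spatial ((Λ : E4 ≃L[ℝ] E4).symm (E4.basisVector 0))‖ ^ 2 =
      (((Λ : E4 ≃L[ℝ] E4) (E4.basisVector 0)) 0) ^ 2 - 1 := by
    have h := lorentz_apply_zero_sq Λ⁻¹
    rw [coe_lorentz_inv, lorentz_symm_apply_basisVector_zero] at h
    have : E4.spatialNorm ((Λ : E4 ≃L[ℝ] E4).symm (E4.basisVector 0)) =
        ‖E4.spatial ((Λ : E4 ≃L[ℝ] E4).symm (E4.basisVector 0))‖ := rfl
    rw [this] at h
    linarith
  have h5 : ‖E4.spatial ((Λ : E4 ≃L[ℝ] E4).symm (E4.basisVector 0))‖ =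
      Real.sqrt ((((Λ : E4 ≃L[ℝ] E4) (E4.basisVector 0)) 0) ^ 2 - 1) := by
    rw [← h4, Real.sqrt_sq (norm_nonneg _)]
  rw [h1, ← h5, abs_neg]
  exact abs_real_inner_le_norm _ _

/-- `√((u⁰)² − 1) ≤ u⁰` for `u⁰ ≥ 0`. [folklore] -/
theorem sqrt_sq_sub_one_le {x : ℝ} (hx : 0 ≤ x) : Real.sqrt (x ^ 2 - 1) ≤ x := by
  rw [Real.sqrt_le_left hx]; linarith

/-! ### The spatial part of the Carter field is short -/

/-- **`‖χ̃‖² ≤ a²/(r² + a²)`** for the Carter field at a point with `r > 0` (`‖χ̃‖² = ω²ϖ²`,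
`ϖ² ≤ r² + a²`). [cite: Carter1968] -/
theorem norm_spatial_carterField_sq_le (a : ℝ) {x : E4} (hx : 0 < Kerr.radius a x) :
    ‖E4.spatial (carterField a x)‖ ^ 2 ≤ a ^ 2 / (Kerr.radius a x ^ 2 + a ^ 2) := by
  obtain ⟨-, h1, h2, h3⟩ := carterField_apply a x
  have hsq : ‖E4.spatial (carterField a x)‖ ^ 2 = (carterField a x 1) ^ 2 + (carterField a x 2) ^ 2 +
      (carterField a x 3) ^ 2 := by
    have := E4.spatialNorm_sq (carterField a x)
    rw [E4.spatialNorm] at this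
    exact this
  rw [hsq, h1, h2, h3]
  set r := Kerr.radius a x with hr
  have hkey := varpi_sq_mul_radius_sq a x
  rw [← hr] at hkey
  have hra : 0 < r ^ 2 + a ^ 2 := by positivity
  have hw : x 1 ^ 2 + x 2 ^ 2 ≤ r ^ 2 + a ^ 2 := by
    have : (x 1 ^ 2 + x 2 ^ 2) * r ^ 2 ≤ (r ^ 2 + a ^ 2) * r ^ 2 := by
      rw [hkey]; nlinarith [sq_nonneg (x 3), sq_nonneg r, sq_nonneg a]
    exact le_of_mul_le_mul_right this (by positivity)
  have heq : (-(a / (r ^ 2 + a ^ 2) * x 2)) ^ 2 + (a / (r ^ 2 + a ^ 2) * x 1) ^ 2 + (0 : ℝ) ^ 2 =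
      a ^ 2 / (r ^ 2 + a ^ 2) * ((x 1 ^ 2 + x 2 ^ 2) / (r ^ 2 + a ^ 2)) := by
    field_simp; ring
  rw [heq]
  have h6 : (x 1 ^ 2 + x 2 ^ 2) / (r ^ 2 + a ^ 2) ≤ 1 := by rwa [div_le_one hra]
  have h7 : 0 ≤ a ^ 2 / (r ^ 2 + a ^ 2) := by positivity
  nlinarith

/-- On `{r ≥ |a|, r > 0}`: `‖χ̃‖ ≤ 3/4` (indeed `≤ 1/√2`). [folklore] -/
theorem norm_spatial_carterField_le (a : ℝ) {x : E4} (hx : 0 < Kerr.radius a x)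
    (har : |a| ≤ Kerr.radius a x) : ‖E4.spatial (carterField a x)‖ ≤ 3 / 4 := by
  have h := norm_spatial_carterField_sq_le a hx
  have ha2 : a ^ 2 ≤ Kerr.radius a x ^ 2 := by rw [← sq_abs a]; exact pow_le_pow_left₀ (abs_nonneg a) har 2
  have h2 : a ^ 2 / (Kerr.radius a x ^ 2 + a ^ 2) ≤ 1 / 2 := by
    rw [div_le_div_iff₀ (by positivity) (by norm_num)]; linarith
  have h3 : ‖E4.spatial (carterField a x)‖ ^ 2 ≤ (3 / 4 : ℝ) ^ 2 := by linarith
  exact (sq_le_sq₀ (norm_nonneg _) (by norm_num)).mp h3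

/-! ### Lab time rises along the Carter field -/

section TimeRaising

variable (Λ : ℝ → lorentzGroup) (ξ : ℝ → E3) (T₀ : ℝ → ℝ)
  (hΛ : ContDiff ℝ ∞ (fun t ↦ ((Λ t : E4 ≃L[ℝ] E4) : E4 →L[ℝ] E4)))
  (hξ : ContDiff ℝ ∞ ξ) (hT₀ : ContDiff ℝ ∞ T₀)

include hΛ hT₀ in
/-- **The clock map raises lab time along the Carter field, uniformly.** For an orthochronous frame
`Λ̃(t)` with slaved tilt rate `(frameTilt ∘ Λ̃)' → 0` and the proper-time clock `T₀` (`T₀' = ũ⁰ ∘ Λ̃ ∘ T₀`,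
`T₀ → ∞`): for every `K ≥ 0`, eventually in the chart time `y⁰`, at every rest point `y` with
`‖ỹ‖ ≤ K` and `r(y) ≥ |a|`, `r(y) > 0`: `DT(y) χ(y) ≥ 1/8`. [cite: Carter1968] -/
theorem clockMap_carter_timeRaising (hclock : ∀ τ, deriv T₀ τ = frameVel (Λ (T₀ τ)) 0)
    (hpos : ∀ t, 0 < frameVel (Λ t) 0)
    (hdec : Tendsto (fun t ↦ deriv (fun s ↦ frameTilt (Λ s)) t) atTop (𝓝 0))
    (htop : Tendsto T₀ atTop atTop) (a : ℝ) {K : ℝ} (hK : 0 ≤ K) :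
    ∃ τK : ℝ, ∀ y : E4, τK ≤ y 0 → ‖E4.spatial y‖ ≤ K → 0 < Kerr.radius a y → |a| ≤ Kerr.radius a y →
      1 / 8 ≤ fderiv ℝ (clockMap Λ T₀) y (carterField a y) := by
  -- thresholds: small tilt rate after `T₁`, clock beyond `T₁` after `τK`
  have hε : (0 : ℝ) < 1 / (8 * (K + 1)) := by positivity
  obtain ⟨T₁, hT₁⟩ := (Metric.tendsto_atTop.mp hdec) _ hε
  obtain ⟨τK, hτK⟩ := eventually_atTop.1 (tendsto_atTop.1 htop T₁)
  refine ⟨τK, fun y hy hyK hr har ↦ ?_⟩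
  set t : ℝ := T₀ (y 0) with ht
  have htT : T₁ ≤ t := hτK _ hy
  -- the differential on `χ`
  obtain ⟨hχ0, -, -, -⟩ := carterField_apply a y
  have hD := (hasFDerivAt_clockMap Λ T₀ hΛ hT₀ y).fderiv
  rw [hD]
  simp only [add_apply, FunLike.coe_smul, Pi.smul_apply,
    ContinuousLinearMap.coe_comp, comp_apply, smul_eq_mul, PiLp.proj_apply, hχ0, mul_one]
  -- the clock rate
  set u0 : ℝ := frameVel (Λ t) 0 with hu0
  have hu01 : 1 ≤ u0 := by
    have h1 := one_le_abs_lorentz_apply_zero (Λ t)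
    have h2 : 0 < u0 := hpos t
    rw [hu0, frameVel] at h2 ⊢
    rwa [abs_of_pos h2] at h1
  have hclk : deriv T₀ (y 0) = u0 := by rw [hclock, ← ht]
  -- the slaved tilt-rate term
  have hd : |deriv (fun s ↦ frameTilt (Λ s)) t (E4.spatial y)| ≤ 1 / 8 := by
    have h1 : ‖deriv (fun s ↦ frameTilt (Λ s)) t‖ ≤ 1 / (8 * (K + 1)) := by
      have := hT₁ t htT
      rw [dist_zero_right] at this
      exact this.le
    have h2 := (deriv (fun s ↦ frameTilt (Λ s)) t).le_opNorm (E4.spatial y)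
    rw [Real.norm_eq_abs] at h2
    calc |deriv (fun s ↦ frameTilt (Λ s)) t (E4.spatial y)|
        ≤ ‖deriv (fun s ↦ frameTilt (Λ s)) t‖ * ‖E4.spatial y‖ := h2
      _ ≤ 1 / (8 * (K + 1)) * K := mul_le_mul h1 hyK (norm_nonneg _) (by positivity)
      _ ≤ 1 / 8 := by
          rw [div_mul_eq_mul_div, div_le_div_iff₀ (by positivity) (by norm_num)]
          nlinarith
  -- the tilt term on the short spatial part of `χ`
  have htilt : |frameTilt (Λ t) (E4.spatial (carterField a y))| ≤ u0 * (3 / 4) := by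
    have h1 := abs_frameTilt_le (Λ t) (E4.spatial (carterField a y))
    have h2 : Real.sqrt ((((Λ t : E4 ≃L[ℝ] E4) (E4.basisVector 0)) 0) ^ 2 - 1) ≤ u0 :=
      sqrt_sq_sub_one_le (by rw [hu0, frameVel] at hu01; exact zero_le_one.trans (by exact hu01))
    have h3 := norm_spatial_carterField_le a hr har
    exact h1.trans (mul_le_mul h2 h3 (norm_nonneg _) (zero_le_one.trans hu01))
  rw [hclk]
  have h1 := (abs_le.mp hd).1
  have h2 := (abs_le.mp htilt).1
  nlinarith

include hΛ hξ hT₀ in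
/-- The time component of the differential of the honest chart is the differential of the clock map.
[folklore] -/
theorem fderiv_honestChart_apply_zero (y v : E4) :
    (fderiv ℝ (honestChart Λ ξ T₀) y v) 0 = fderiv ℝ (clockMap Λ T₀) y v := by
  have hH := hasFDerivAt_honestChart Λ ξ T₀ hΛ hξ y (hasFDerivAt_clockMap Λ T₀ hΛ hT₀ y)
  have hc := (EuclideanSpace.proj (0 : Fin 4) : E4 →L[ℝ] ℝ).hasFDerivAt.comp y hH
  have heq : ((EuclideanSpace.proj (0 : Fin 4) : E4 →L[ℝ] ℝ) ∘ honestChart Λ ξ T₀) = clockMap Λ T₀ :=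
    funext fun y ↦ honestChart_apply_zero Λ ξ T₀ y
  rw [heq] at hc
  rw [hc.fderiv, hH.fderiv]
  rfl

include hΛ hξ hT₀ in
/-- **The honest chart raises lab time along the Carter field, uniformly** (the input
`0 < (DA·χ)⁰` of `isFutureDirected_mfderiv_flow_of_deviation` for `A = honestChart`). [cite: Carter1968] -/
theorem honestChart_carter_timeRaising (hclock : ∀ τ, deriv T₀ τ = frameVel (Λ (T₀ τ)) 0)
    (hpos : ∀ t, 0 < frameVel (Λ t) 0)
    (hdec : Tendsto (fun t ↦ deriv (fun s ↦ frameTilt (Λ s)) t) atTop (𝓝 0))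
    (htop : Tendsto T₀ atTop atTop) (a : ℝ) {K : ℝ} (hK : 0 ≤ K) :
    ∃ τK : ℝ, ∀ y : E4, τK ≤ y 0 → ‖E4.spatial y‖ ≤ K → 0 < Kerr.radius a y → |a| ≤ Kerr.radius a y →
      1 / 8 ≤ (fderiv ℝ (honestChart Λ ξ T₀) y (carterField a y)) 0 := by
  obtain ⟨τK, h⟩ := clockMap_carter_timeRaising Λ T₀ hΛ hT₀ hclock hpos hdec htop a hK
  exact ⟨τK, fun y hy hyK hr har ↦ by
    rw [fderiv_honestChart_apply_zero Λ ξ T₀ hΛ hξ hT₀]; exact h y hy hyK hr har⟩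

end TimeRaising

/-- Registered one-line form (stub `sqrt_sq_sub_one_le_rechart` of the crux item) of
`sqrt_sq_sub_one_le`. [folklore] -/
theorem sqrt_sq_sub_one_le_rechart : ∀ {x : ℝ}, 0 ≤ x → Real.sqrt (x ^ 2 - 1) ≤ x :=
  fun hx ↦ sqrt_sq_sub_one_le hx

end Summit.FinalStateConjecture.FinalStateConjecture.Theorems
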